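import Literature.NumberTheory.LFunctions.BettinConreyFarmer2013ExplicitFormula
import Mathlib.Analysis.Complex.LocallyUniformLimit
import HarnessLib

/-!
# Bettin–Conrey–Farmer 2013, Theorem 1 — `Z_N(s) = ∑_ρ N^{ρ−s}/(ζ'(ρ)(ρ−s)²)` as a function of `s`

Topic `Literature/NumberTheory/LFunctions`; fourth "Proofs" companion of
`BettinConreyFarmer2013.lean`. Everything here is PROVED. Under RH and condition (2) the series
`Z_N(s)` (`BCF.zeroSum`, summed over the distinct non-trivial zeros) converges absolutely and
locally uniformly off the zeros, so it is holomorphic on `ℂ ∖ {zeros}` (`BCF.differentiableOn_zeroSum`),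
and near a zero `ρ₀` it is `N^{ρ₀−s}/(ζ'(ρ₀)(s−ρ₀)²)` plus a function holomorphic at `ρ₀`
(`BCF.zeroSum_eq_zeroTerm_add`, `BCF.differentiableOn_zeroSumOff`): the double poles of the
integrand of the main term in the proof of Theorem 1 ([BettinConreyFarmer2013, §3, last display of
the proof]). Also: `‖Z_N(s)‖ ≤ N^{1/2−Re s} ∑_ρ 1/(|ζ'(ρ)||ρ−s|²)` (`BCF.norm_zeroSum_le`).

## References

* S. Bettin, J. B. Conrey, D. W. Farmer, Proc. Steklov Inst. Math. 280 (2013), suppl. 2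
  (arXiv:1211.5191), §3, Lemma 2 and proof of Theorem 1. [BettinConreyFarmer2013]
-/

noncomputable section

open Complex Filter Set Real Metric
open scoped Topology ComplexConjugate

namespace Literature.NumberTheory.LFunctions

namespace BCF

/-! ## The terms -/

/-- The term of `Z_N` at the zero `ρ`: `N^{ρ−s}/(ζ'(ρ)(ρ−s)²)`. [cite: BettinConreyFarmer2013, §3, Lemma 2] -/
def zeroTerm (N : ℕ) (ρ s : ℂ) : ℂ := (N : ℂ) ^ (ρ - s) / (deriv riemannZeta ρ * (ρ - s) ^ 2)

/-- `Z_N(s) = ∑_ρ zeroTerm N ρ s`. [folklore] -/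
theorem zeroSum_eq_tsum (N : ℕ) (s : ℂ) :
    zeroSum N s = ∑' ρ : ZetaZeros.riemannZetaNontrivialZeros, zeroTerm N ρ s := rfl

/-- `Z_N` without the zero `ρ₀`: `∑_{ρ ≠ ρ₀} zeroTerm N ρ s`. [cite: BettinConreyFarmer2013, §3, proof of Thm. 1] -/
def zeroSumOff (N : ℕ) (ρ₀ s : ℂ) : ℂ :=
  ∑' ρ : ZetaZeros.riemannZetaNontrivialZeros, if (ρ : ℂ) = ρ₀ then 0 else zeroTerm N ρ s

/-- The term is holomorphic in `s` away from `s = ρ`. [folklore] -/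
theorem differentiableAt_zeroTerm {N : ℕ} (hN : 2 ≤ N) (ρ : ℂ) {s : ℂ} (h : s ≠ ρ) :
    DifferentiableAt ℂ (zeroTerm N ρ) s := by
  have hN0 : (N : ℂ) ≠ 0 := by exact_mod_cast (show N ≠ 0 by omega)
  by_cases hd : deriv riemannZeta ρ = 0
  · have : zeroTerm N ρ = fun _ ↦ 0 := by funext z; simp [zeroTerm, hd]
    rw [this]; exact differentiableAt_const _
  have h1 : DifferentiableAt ℂ (fun s : ℂ ↦ (N : ℂ) ^ (ρ - s)) s :=
    (((hasDerivAt_id s).const_sub ρ).const_cpow (Or.inl hN0)).differentiableAt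
  exact h1.div (((differentiableAt_id.const_sub ρ).pow 2).const_mul _)
    (mul_ne_zero hd (pow_ne_zero 2 (sub_ne_zero.2 (Ne.symm h))))

/-- The norm of the term under RH: `N^{1/2−Re s}/(|ζ'(ρ)| |ρ−s|²)`. [folklore] -/
theorem norm_zeroTerm_eq (hRH : RiemannHypothesis) {N : ℕ} (hN : 2 ≤ N) (s : ℂ) {ρ : ℂ}
    (hρ : ρ ∈ ZetaZeros.riemannZetaNontrivialZeros) :
    ‖zeroTerm N ρ s‖ = (N : ℝ) ^ (1 / 2 - s.re) * (1 / (‖deriv riemannZeta ρ‖ * ‖ρ - s‖ ^ 2)) :=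
  norm_zeroTerm hRH hN s hρ

/-! ## Distance from the other zeros, and comparison of `|ρ − s|` with `|ρ|` -/

/-- Every point `s` is at positive distance from the non-trivial zeros other than itself (they are
locally finite). [folklore] -/
theorem exists_dist_le (s : ℂ) :
    ∃ d : ℝ, 0 < d ∧ d ≤ 1 ∧ ∀ ρ ∈ ZetaZeros.riemannZetaNontrivialZeros, ρ ≠ s → d ≤ ‖ρ - s‖ := by
  classical
  set F := ((ntz_finite_abs_im_le (|s.im| + 1)).toFinset.erase s) with hF
  by_cases hne : F.Nonempty
  · set d₀ := F.inf' hne (fun ρ ↦ ‖ρ - s‖) with hd₀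
    have hd₀pos : 0 < d₀ := by
      rw [hd₀, Finset.lt_inf'_iff]
      intro ρ hρ
      exact norm_pos_iff.2 (sub_ne_zero.2 (Finset.mem_erase.1 hρ).1)
    refine ⟨min d₀ 1, lt_min hd₀pos one_pos, min_le_right _ _, fun ρ hρ hρs ↦ ?_⟩
    by_cases hnear : |ρ.im| ≤ |s.im| + 1
    · have hmem : ρ ∈ F := by
        rw [hF, Finset.mem_erase, Set.Finite.mem_toFinset]
        exact ⟨hρs, hρ, hnear⟩
      exact (min_le_left _ _).trans (Finset.inf'_le _ hmem)
    · rw [not_le] at hnear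
      refine (min_le_right _ _).trans ?_
      have h1 : |ρ.im - s.im| ≤ ‖ρ - s‖ := by
        have := Complex.abs_im_le_norm (ρ - s); simpa using this
      have h2 : |ρ.im| - |s.im| ≤ |ρ.im - s.im| := abs_sub_abs_le_abs_sub _ _
      linarith
  · refine ⟨1, one_pos, le_rfl, fun ρ hρ hρs ↦ ?_⟩
    have hnot : ρ ∉ F := fun h ↦ hne ⟨ρ, h⟩
    have hfar : ¬ |ρ.im| ≤ |s.im| + 1 := by
      intro hle
      exact hnot (by rw [hF, Finset.mem_erase, Set.Finite.mem_toFinset]; exact ⟨hρs, hρ, hle⟩)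
    rw [not_le] at hfar
    have h1 : |ρ.im - s.im| ≤ ‖ρ - s‖ := by
      have := Complex.abs_im_le_norm (ρ - s); simpa using this
    have h2 : |ρ.im| - |s.im| ≤ |ρ.im - s.im| := abs_sub_abs_le_abs_sub _ _
    linarith

/-- If `‖ρ − s₀‖ ≥ d > 0` then `1/‖ρ − s‖² ≤ 4(1 + ‖s₀‖/d)²/‖ρ‖²` for every `s` with
`‖s − s₀‖ ≤ d/2` (and `ρ ≠ 0`). [folklore] -/
theorem inv_norm_sub_sq_le {ρ s₀ s : ℂ} {d : ℝ} (hd : 0 < d) (hρ : d ≤ ‖ρ - s₀‖) (hρ0 : ρ ≠ 0)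
    (hs : ‖s - s₀‖ ≤ d / 2) :
    1 / ‖ρ - s‖ ^ 2 ≤ 4 * (1 + ‖s₀‖ / d) ^ 2 / ‖ρ‖ ^ 2 := by
  have h1 : ‖ρ - s₀‖ / 2 ≤ ‖ρ - s‖ := by
    have := norm_sub_norm_le (ρ - s₀) (s - s₀)
    have e : ρ - s₀ - (s - s₀) = ρ - s := by ring
    rw [e] at this
    linarith
  have h2 : ‖ρ‖ ≤ (1 + ‖s₀‖ / d) * ‖ρ - s₀‖ := by
    have h3 : ‖ρ‖ ≤ ‖ρ - s₀‖ + ‖s₀‖ := by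
      have := norm_add_le (ρ - s₀) s₀; simpa using this
    have h4 : ‖s₀‖ ≤ ‖s₀‖ / d * ‖ρ - s₀‖ := by
      rw [div_mul_eq_mul_div, le_div_iff₀ hd]
      exact mul_le_mul_of_nonneg_left hρ (norm_nonneg _)
    nlinarith
  have hρpos : 0 < ‖ρ‖ := norm_pos_iff.2 hρ0
  have hρs : 0 < ‖ρ - s‖ := lt_of_lt_of_le (by linarith) h1
  rw [div_le_div_iff₀ (by positivity) (by positivity), one_mul]
  have h5 : ‖ρ‖ ≤ (1 + ‖s₀‖ / d) * (2 * ‖ρ - s‖) := h2.trans (by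
    have : 0 ≤ 1 + ‖s₀‖ / d := by positivity
    nlinarith)
  have h0 : 0 ≤ (1 + ‖s₀‖ / d) * (2 * ‖ρ - s‖) := by positivity
  nlinarith [norm_nonneg ρ]

/-! ## Local uniform summability -/

/-- **Uniform majorant near `s₀`.** Under RH and (2): if all zeros other than `s₀` are at distance
`≥ d` from `s₀` (`0 < d ≤ 1`), then on the closed ball `‖s − s₀‖ ≤ d/2` every term `ρ ≠ s₀` of `Z_N`
satisfies `‖zeroTerm N ρ s‖ ≤ M/(|ζ'(ρ)| ‖ρ‖²)` with `M = 4 N^{1/2−Re s₀+1/2}(1+‖s₀‖/d)²`, a summable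
majorant. [cite: BettinConreyFarmer2013, §3, Lemma 3 (convergence)] -/
theorem norm_zeroTerm_le_majorant (hRH : RiemannHypothesis) {N : ℕ} (hN : 2 ≤ N) {s₀ : ℂ} {d : ℝ}
    (hd : 0 < d) (hd1 : d ≤ 1) {ρ : ℂ} (hρ : ρ ∈ ZetaZeros.riemannZetaNontrivialZeros)
    (hρd : d ≤ ‖ρ - s₀‖) {s : ℂ} (hs : ‖s - s₀‖ ≤ d / 2) :
    ‖zeroTerm N ρ s‖ ≤ 4 * (N : ℝ) ^ (1 - s₀.re) * (1 + ‖s₀‖ / d) ^ 2 *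
      (1 / (‖deriv riemannZeta ρ‖ * ‖ρ‖ ^ 2)) := by
  have hN1 : (1 : ℝ) ≤ N := by exact_mod_cast (show 1 ≤ N by omega)
  have hρ0 : ρ ≠ 0 := fun h ↦ by
    have := ntz_re hRH hρ; rw [h, zero_re] at this; norm_num at this
  rw [norm_zeroTerm_eq hRH hN s hρ]
  have hre : |s.re - s₀.re| ≤ d / 2 := by
    have := Complex.abs_re_le_norm (s - s₀); rw [sub_re] at this; exact this.trans hs
  have hpow : (N : ℝ) ^ (1 / 2 - s.re) ≤ (N : ℝ) ^ (1 - s₀.re) := by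
    refine Real.rpow_le_rpow_of_exponent_le hN1 ?_
    rw [abs_le] at hre; linarith
  have hcmp := inv_norm_sub_sq_le hd hρd hρ0 hs
  have hdpos : 0 ≤ ‖deriv riemannZeta ρ‖ := norm_nonneg _
  rcases eq_or_lt_of_le hdpos with h0 | h0
  · -- `ζ'(ρ) = 0`: both sides vanish
    rw [← h0]; simp
  · have e1 : 1 / (‖deriv riemannZeta ρ‖ * ‖ρ - s‖ ^ 2) = (1 / ‖deriv riemannZeta ρ‖) * (1 / ‖ρ - s‖ ^ 2) := by
      rw [one_div_mul_one_div]
    have e2 : 1 / (‖deriv riemannZeta ρ‖ * ‖ρ‖ ^ 2) = (1 / ‖deriv riemannZeta ρ‖) * (1 / ‖ρ‖ ^ 2) := by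
      rw [one_div_mul_one_div]
    rw [e1, e2]
    have h3 : (1 / ‖deriv riemannZeta ρ‖) * (1 / ‖ρ - s‖ ^ 2) ≤
        (1 / ‖deriv riemannZeta ρ‖) * (4 * (1 + ‖s₀‖ / d) ^ 2 / ‖ρ‖ ^ 2) :=
      mul_le_mul_of_nonneg_left hcmp (by positivity)
    calc (N : ℝ) ^ (1 / 2 - s.re) * (1 / ‖deriv riemannZeta ρ‖ * (1 / ‖ρ - s‖ ^ 2))
        ≤ (N : ℝ) ^ (1 - s₀.re) * (1 / ‖deriv riemannZeta ρ‖ * (4 * (1 + ‖s₀‖ / d) ^ 2 / ‖ρ‖ ^ 2)) :=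
          mul_le_mul hpow h3 (by positivity) (by positivity)
      _ = 4 * (N : ℝ) ^ (1 - s₀.re) * (1 + ‖s₀‖ / d) ^ 2 * (1 / ‖deriv riemannZeta ρ‖ * (1 / ‖ρ‖ ^ 2)) := by
          ring

/-! ## Holomorphy of `Z_N` off the zeros, and the local structure at a zero -/

/-- **`Z_N` minus the `ρ₀`-term is holomorphic near `ρ₀`** (for `ρ₀` a zero or not): on the open
ball of radius `d/2` about `ρ₀`, `d` the distance of `ρ₀` from the other zeros.
[cite: BettinConreyFarmer2013, §3, proof of Thm. 1] -/
theorem differentiableOn_zeroSumOff (hRH : RiemannHypothesis) {δ C : ℝ} (hδ : 0 < δ)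
    (hC : ∀ T : ℝ, 2 ≤ T →
      ∑ᶠ ρ ∈ zetaZeroBox 0 T, 1 / ‖deriv riemannZeta ρ‖ ^ 2 ≤ C * T ^ (3 / 2 - δ))
    {N : ℕ} (hN : 2 ≤ N) (ρ₀ : ℂ) {d : ℝ} (hd : 0 < d) (hd1 : d ≤ 1)
    (hdist : ∀ ρ ∈ ZetaZeros.riemannZetaNontrivialZeros, ρ ≠ ρ₀ → d ≤ ‖ρ - ρ₀‖) :
    DifferentiableOn ℂ (zeroSumOff N ρ₀) (ball ρ₀ (d / 2)) := by
  classical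
  set M : ℝ := 4 * (N : ℝ) ^ (1 - ρ₀.re) * (1 + ‖ρ₀‖ / d) ^ 2 with hM
  set u : ZetaZeros.riemannZetaNontrivialZeros → ℝ := fun ρ ↦
    M * (1 / (‖deriv riemannZeta ρ‖ * ‖(ρ : ℂ)‖ ^ 2)) with hu
  have hsum : Summable u := (summable_inv_deriv_mul_norm_sq hRH hδ hC).mul_left M
  refine differentiableOn_tsum_of_summable_norm hsum (fun ρ ↦ ?_) isOpen_ball (fun ρ s hs ↦ ?_)
  · -- each term is holomorphic on the ball
    intro s hs
    by_cases hρ : (ρ : ℂ) = ρ₀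
    · simp only [hρ, if_true]; exact (differentiableAt_const _).differentiableWithinAt
    · simp only [hρ, if_false]
      refine (differentiableAt_zeroTerm hN _ ?_).differentiableWithinAt
      intro h
      have h1 := hdist ρ ρ.2 hρ
      rw [mem_ball, dist_eq_norm, h] at hs
      linarith
  · by_cases hρ : (ρ : ℂ) = ρ₀
    · simp only [hρ, if_true, norm_zero]
      rw [hu]; positivity
    · simp only [hρ, if_false]
      rw [mem_ball, dist_eq_norm] at hs
      exact norm_zeroTerm_le_majorant hRH hN hd hd1 ρ.2 (hdist ρ ρ.2 hρ) hs.le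

/-- The punctured family is summable near `ρ₀`. [folklore] -/
theorem summable_zeroTerm_ite (hRH : RiemannHypothesis) {δ C : ℝ} (hδ : 0 < δ)
    (hC : ∀ T : ℝ, 2 ≤ T →
      ∑ᶠ ρ ∈ zetaZeroBox 0 T, 1 / ‖deriv riemannZeta ρ‖ ^ 2 ≤ C * T ^ (3 / 2 - δ))
    {N : ℕ} (hN : 2 ≤ N) (ρ₀ : ℂ) {d : ℝ} (hd : 0 < d) (hd1 : d ≤ 1)
    (hdist : ∀ ρ ∈ ZetaZeros.riemannZetaNontrivialZeros, ρ ≠ ρ₀ → d ≤ ‖ρ - ρ₀‖)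
    {s : ℂ} (hs : ‖s - ρ₀‖ ≤ d / 2) :
    Summable fun ρ : ZetaZeros.riemannZetaNontrivialZeros ↦
      if (ρ : ℂ) = ρ₀ then (0 : ℂ) else zeroTerm N ρ s := by
  classical
  set M : ℝ := 4 * (N : ℝ) ^ (1 - ρ₀.re) * (1 + ‖ρ₀‖ / d) ^ 2 with hM
  have hsum : Summable fun ρ : ZetaZeros.riemannZetaNontrivialZeros ↦
      M * (1 / (‖deriv riemannZeta ρ‖ * ‖(ρ : ℂ)‖ ^ 2)) :=
    (summable_inv_deriv_mul_norm_sq hRH hδ hC).mul_left M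
  refine Summable.of_norm_bounded hsum fun ρ ↦ ?_
  by_cases hρ : (ρ : ℂ) = ρ₀
  · simp only [hρ, if_true, norm_zero]; positivity
  · simp only [hρ, if_false]
    exact norm_zeroTerm_le_majorant hRH hN hd hd1 ρ.2 (hdist ρ ρ.2 hρ) hs

/-- **Local structure of `Z_N` at a zero**: if `ρ₀` is a non-trivial zero, then for `s` near `ρ₀`
(within half the distance to the other zeros), `Z_N(s) = zeroTerm N ρ₀ s + zeroSumOff N ρ₀ s`.
[cite: BettinConreyFarmer2013, §3, proof of Thm. 1] -/
theorem zeroSum_eq_zeroTerm_add (hRH : RiemannHypothesis) {δ C : ℝ} (hδ : 0 < δ)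
    (hC : ∀ T : ℝ, 2 ≤ T →
      ∑ᶠ ρ ∈ zetaZeroBox 0 T, 1 / ‖deriv riemannZeta ρ‖ ^ 2 ≤ C * T ^ (3 / 2 - δ))
    {N : ℕ} (hN : 2 ≤ N) {ρ₀ : ℂ} (hρ₀ : ρ₀ ∈ ZetaZeros.riemannZetaNontrivialZeros)
    {d : ℝ} (hd : 0 < d) (hd1 : d ≤ 1)
    (hdist : ∀ ρ ∈ ZetaZeros.riemannZetaNontrivialZeros, ρ ≠ ρ₀ → d ≤ ‖ρ - ρ₀‖)
    {s : ℂ} (hs : ‖s - ρ₀‖ ≤ d / 2) :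
    zeroSum N s = zeroTerm N ρ₀ s + zeroSumOff N ρ₀ s := by
  classical
  -- the full family is summable at `s`: it differs from the punctured one in one term
  have hp := summable_zeroTerm_ite hRH hδ hC hN ρ₀ hd hd1 hdist hs
  set ρ₀' : ZetaZeros.riemannZetaNontrivialZeros := ⟨ρ₀, hρ₀⟩
  have hfull : Summable fun ρ : ZetaZeros.riemannZetaNontrivialZeros ↦ zeroTerm N ρ s := by
    have h := hp.add (summable_of_ne_finset_zero (s := {ρ₀'})
      (f := fun ρ : ZetaZeros.riemannZetaNontrivialZeros ↦ if (ρ : ℂ) = ρ₀ then zeroTerm N ρ s else 0)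
      (fun ρ hρ ↦ by
        have : (ρ : ℂ) ≠ ρ₀ := fun h ↦ by
          apply hρ; rw [Finset.mem_singleton]; exact Subtype.ext h
        simp [this]))
    refine h.congr fun ρ ↦ ?_
    by_cases hρ : (ρ : ℂ) = ρ₀ <;> simp [hρ]
  rw [zeroSum_eq_tsum, hfull.tsum_eq_add_tsum_ite ρ₀', zeroSumOff]
  congr 1
  refine tsum_congr fun ρ ↦ ?_
  by_cases hρ : (ρ : ℂ) = ρ₀
  · have : ρ = ρ₀' := Subtype.ext hρ
    subst this
    rw [if_pos rfl, if_pos hρ]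
  · have : ρ ≠ ρ₀' := fun h ↦ hρ (by rw [h])
    rw [if_neg this, if_neg hρ]

/-- **`Z_N` is holomorphic off the zeros.** [cite: BettinConreyFarmer2013, §3, Lemma 2] -/
theorem differentiableOn_zeroSum (hRH : RiemannHypothesis) {δ C : ℝ} (hδ : 0 < δ)
    (hC : ∀ T : ℝ, 2 ≤ T →
      ∑ᶠ ρ ∈ zetaZeroBox 0 T, 1 / ‖deriv riemannZeta ρ‖ ^ 2 ≤ C * T ^ (3 / 2 - δ))
    {N : ℕ} (hN : 2 ≤ N) :
    DifferentiableOn ℂ (zeroSum N) (ZetaZeros.riemannZetaNontrivialZeros)ᶜ := by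
  intro s₀ hs₀
  obtain ⟨d, hd, hd1, hdist⟩ := exists_dist_le s₀
  -- on the ball about `s₀`, `Z_N = zeroSumOff N s₀` (no term is removed)
  have heq : ∀ s ∈ ball s₀ (d / 2), zeroSum N s = zeroSumOff N s₀ s := by
    intro s _
    rw [zeroSum_eq_tsum, zeroSumOff]
    refine tsum_congr fun ρ ↦ ?_
    have : (ρ : ℂ) ≠ s₀ := fun h ↦ hs₀ (h ▸ ρ.2)
    simp [this]
  have hdiff := differentiableOn_zeroSumOff hRH hδ hC hN s₀ hd hd1 hdist
  have hball : ball s₀ (d / 2) ∈ 𝓝 s₀ := ball_mem_nhds _ (by positivity)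
  have h1 : DifferentiableAt ℂ (zeroSumOff N s₀) s₀ := hdiff.differentiableAt hball
  refine (h1.congr_of_eventuallyEq ?_).differentiableWithinAt
  filter_upwards [hball] with s hs using heq s hs

/-- **`Z_N` is analytic at every point that is not a non-trivial zero.** [folklore] -/
theorem analyticAt_zeroSum (hRH : RiemannHypothesis) {δ C : ℝ} (hδ : 0 < δ)
    (hC : ∀ T : ℝ, 2 ≤ T →
      ∑ᶠ ρ ∈ zetaZeroBox 0 T, 1 / ‖deriv riemannZeta ρ‖ ^ 2 ≤ C * T ^ (3 / 2 - δ))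
    {N : ℕ} (hN : 2 ≤ N) {s : ℂ} (hs : s ∉ ZetaZeros.riemannZetaNontrivialZeros) :
    AnalyticAt ℂ (zeroSum N) s := by
  obtain ⟨d, hd, -, hdist⟩ := exists_dist_le s
  have hball : ball s d ⊆ (ZetaZeros.riemannZetaNontrivialZeros)ᶜ := by
    intro z hz hzmem
    have h := hdist z hzmem (fun h ↦ hs (h ▸ hzmem))
    rw [mem_ball, dist_eq_norm] at hz
    linarith
  exact ((differentiableOn_zeroSum hRH hδ hC hN).mono hball).analyticAt (ball_mem_nhds _ hd)

/-! ## The size of `Z_N` -/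

/-- **`‖Z_N(s)‖ ≤ N^{1/2 − Re s} ∑_ρ 1/(|ζ'(ρ)| |ρ−s|²)`** whenever the right-hand family is summable.
[cite: BettinConreyFarmer2013, §3, Lemma 3] -/
theorem norm_zeroSum_le (hRH : RiemannHypothesis) {N : ℕ} (hN : 2 ≤ N) {s : ℂ}
    (hsum : Summable fun ρ : ZetaZeros.riemannZetaNontrivialZeros ↦
      1 / (‖deriv riemannZeta ρ‖ * ‖(ρ : ℂ) - s‖ ^ 2)) :
    ‖zeroSum N s‖ ≤ (N : ℝ) ^ (1 / 2 - s.re) *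
      ∑' ρ : ZetaZeros.riemannZetaNontrivialZeros, 1 / (‖deriv riemannZeta ρ‖ * ‖(ρ : ℂ) - s‖ ^ 2) := by
  have hnorm : Summable fun ρ : ZetaZeros.riemannZetaNontrivialZeros ↦ ‖zeroTerm N ρ s‖ := by
    refine (hsum.mul_left ((N : ℝ) ^ (1 / 2 - s.re))).congr fun ρ ↦ ?_
    rw [norm_zeroTerm_eq hRH hN s ρ.2]
  rw [zeroSum_eq_tsum, ← tsum_mul_left]
  refine (norm_tsum_le_tsum_norm hnorm).trans (le_of_eq (tsum_congr fun ρ ↦ ?_))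
  exact norm_zeroTerm_eq hRH hN s ρ.2

end BCF

end Literature.NumberTheory.LFunctions

end
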